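/-
Copyright (c) 2026 the pub-hodgecm-mathlib formalisation cell (harness21).  Prover seat hodgecm-mathlib-K2E1-p09 (g3), Track B ∕ K2-LIT,
h413 = `stmt-HodgeConjecture-24833`, line `K2_E1_TraceFormulaBeta`, campaign RES-RANK-ONE (owner K2E1-p02 (g4)), brick (H2), file F2b: pseudo-Eisenstein series
on `X = G(𝔸) ⧸ G(K)` are ORTHOGONAL to the cuspidal subspace.  2026-09-04.
-/
import Summits.HodgeConjecture.HodgeConjecture.Theorems.K2E1PseudoEisensteinAdjunction   -- ★ (F2a): the Bochner adjunction; F1 transitively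
import Mathlib.MeasureTheory.Function.L2Space
import Mathlib.MeasureTheory.Integral.MeanInequalities
import Mathlib.Analysis.InnerProductSpace.Orthogonal
import HarnessLib

/-!
# h413 ∕ Track B «K2-LIT», campaign RES-RANK-ONE, brick (H2) file F2b — helper `K2E1PseudoEisensteinCuspOrthogonal`:
# `⟨θ_Φ, φ⟩ = 0` for every continuous square-integrable cusp form `φ`, and `θ_Φ ∈ (L²_cusp)ᗮ`

Cell `pub/hodgecm-mathlib`, crux H413 = `stmt-HodgeConjecture-24833`, route `HCCMUnconditional`; chair K2-lead (g0), dealer K2E1-plan (g2), DEAL (H2)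
2026-09-04T02:16:09Z ∕ ruling 02:21:21Z.  THEOREMS ONLY (no `def`, no `instance`, no `notation`, no named-fact hypothesis, no `sorry`); lane
`--kind proof --supports stmt-HodgeConjecture-24833 --as helper` (count-neutral).

For an adelic group datum `𝒢` with `A_G = 1` (`hQ : quotientSubgroup = arithmeticSubgroup`, ★ `cmDatum`), `G(K)` discrete in `G(𝔸)` (locally compact second
countable Hausdorff), a radical `N = 𝔓.radical i` (closed, with an inversion-invariant Haar measure `ν_N`), an AUTOMORPHIC measure `μ` on `X = 𝒢.automorphicQuotient`
and an invariant measure `μ_N ≠ 0` on `G(𝔸) ⧸ N(𝔸)`; `θ_Φ(x) = Σ'_{q ∈ G(K)⧸N(K)} Φ(x̃ q̃)` for a Borel right-`N(𝔸)`-invariant `Φ : G(𝔸) → ℂ`: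

* §1 `measurable_tsum_enorm` — `θ_{‖Φ‖}` is Borel on `G ⧸ Γ` (it IS a fibre integral, ★ `measurable_fiberLIntegral`); the ADELIC READING of ★ F2a with the
  house instances supplied INSIDE the statement (`letI := ★ measurableSpaceQuotientForm`, as ★ `integrable_tsum_quotient_and_integral_eq_mul_integral_of_subgroup_fin`):
  **`adelic_integrable_and_integral_pseudoEisenstein_mul_eq`** — `θ_Φ ψ ∈ L¹(μ)` and `c_N ∫_X θ_Φ ψ dμ = c_Γ ∫_{G(𝔸)⧸N(𝔸)} Φ(ỹ) (∫_𝓕 ψ((ỹu⁻¹)·G(K)) dν_N) dμ_N`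
  for every fundamental domain `𝓕` of `𝔓.rational i` (the ★ `ConstantTermVanishes` data), under `∫⁻_X θ_{‖Φ‖} ‖ψ‖ dμ < ∞`.
* §2 **`integral_pseudoEisenstein_mul_conj_eq_zero_of_mem_cuspForms`** — for `φ ∈ ★ cuspForms μ 𝔓` (continuous, `L²`, all constant terms vanish) with
  `∫⁻_X θ_{‖Φ‖} ‖φ‖ dμ < ∞`: `∫_X θ_Φ · conj φ dμ = 0` (the constant term of `conj φ` along `N` vanishes at every point, `integral_conj`; `c_N ≠ 0`).
* §3 under the SQUARE-INTEGRABILITY HYPOTHESIS `∫⁻_X θ_{‖Φ‖}² dμ < ∞` (in print: reduction theory — `θ_φ` is bounded with compact support modulo `G(K)` for `φ`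
  compactly supported modulo `N(𝔸)`, [MoeglinWaldspurger1995, II.1.2]; dischargeable for `U(Φ₂)`, `U(Φ₃)` from the ★ E1 Siegel-domain files, NOT generic):
  `memLp_pseudoEisenstein` (`θ_Φ ∈ L²(μ)`), the finiteness `∫⁻ θ_{‖Φ‖}‖φ‖ < ∞` for every `φ ∈ L²` (Hölder), and
  **`toLp_pseudoEisenstein_mem_orthogonal_cuspidalSubspace`**: `[θ_Φ] ∈ (★ cuspidalSubspace μ 𝔓)ᗮ` (orthogonal to the range of ★ `cuspFormsToLp`, hence to its
  closure, Mathlib `Submodule.orthogonal_closure`).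

WHAT IS NOT HERE.  The converse «`[ψ] ⊥ θ_Φ` for all `Φ, i` ⟹ `ψ` cuspidal» (F3, for continuous `ψ`); «`(L²_cusp)ᗮ = closure span θ_Φ`» needs in addition the
density of continuous cusp forms among a.e.-cusp forms (smoothing by `R(f)`; cf. ★ p855526) — not here.

HONEST LABEL.  Count-neutral helper; proves no printed statement; HC_CM is proved only modulo the 7 printed citations (2 remaining named inputs: hLiu418 =
`stmt-HodgeConjecture-24832`, h413 = `stmt-HodgeConjecture-24833`) until rung 0 closes.

## References
* [MoeglinWaldspurger1995] C. Mœglin, J.-L. Waldspurger, *Spectral decomposition and Eisenstein series* (1995), II.1.1–II.1.3, I.2.6.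
* [Garrett2018] P. Garrett, *Modern Analysis of Automorphic Forms by Example*, vol. 1 (2018), §1.8.
* [BorelJacquet1979] A. Borel, H. Jacquet, *Automorphic forms and automorphic representations*, PSPM 33.1 (1979), §4.4–4.6.
* [GetzHahn2024] J. R. Getz, H. Hahn, *An Introduction to Automorphic Representations* (2024), Thm. 3.2.2, §9.1.
-/

set_option autoImplicit false
set_option linter.dupNamespace false  -- the mandated namespace repeats the summit's segment (`HodgeConjecture.HodgeConjecture`)

noncomputable section

open MeasureTheory Measure Set Filter Topology
open Literature.MeasureTheory.Group Literature.NumberTheory.Automorphic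
open Summit.HodgeConjecture.HodgeConjecture.Cruxes.H413.K2E1PseudoEisensteinUnfolding
open Summit.HodgeConjecture.HodgeConjecture.Cruxes.H413.K2E1PseudoEisensteinAdjunction
open scoped ENNReal NNReal Pointwise InnerProductSpace ComplexConjugate

namespace Summit.HodgeConjecture.HodgeConjecture.Cruxes.H413.K2E1PseudoEisensteinCuspOrthogonal

/-! ## §1 Measurability of `θ_{‖Φ‖}`; the adelic reading of the adjunction -/

section Measurable

variable {G : Type*} [Group G] [TopologicalSpace G] [IsTopologicalGroup G] [LocallyCompactSpace G] [SecondCountableTopology G] [T2Space G]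
  [MeasurableSpace G] [BorelSpace G] (Γ N : Subgroup G) [DiscreteTopology Γ] [MeasurableSpace (G ⧸ Γ)] [BorelSpace (G ⧸ Γ)]

/-- `θ_{‖Φ‖} : x ↦ Σ'_{q ∈ Γ⧸Γ∩N} ‖Φ(x̃ q̃)‖` is Borel on `G ⧸ Γ`: it is the fibre integral along `Γ` (counting measure) of `‖Φ‖ · β` for a weight `β` of covering sum
one (★ F1 `tsum_mul_mul_weight_eq`, ★ `measurable_fiberLIntegral`). [folklore] -/
theorem measurable_tsum_enorm {Φ : G → ℂ} (hΦm : Measurable Φ) (hΦ : ∀ (g : G) (n : N), Φ (g * n) = Φ g) :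
    Measurable fun x : G ⧸ Γ => ∑' q : Γ ⧸ N.subgroupOf Γ, ‖Φ (x.out * (q.out : G))‖ₑ := by
  haveI : IsClosed (Γ : Set G) := Subgroup.isClosed_of_discrete
  obtain ⟨β, hβm, hβ⟩ := exists_weight Γ N
  have hΦ' : ∀ (g : G) (n : N), ‖Φ (g * n)‖ₑ = ‖Φ g‖ₑ := fun g n => by rw [hΦ]
  have heq : (fun x : G ⧸ Γ => ∑' q : Γ ⧸ N.subgroupOf Γ, ‖Φ (x.out * (q.out : G))‖ₑ) =
      fiberLIntegral Γ count (fun g => ‖Φ g‖ₑ * 1 * β g) := by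
    funext x
    conv_rhs => rw [← QuotientGroup.out_eq' x]
    rw [LevelOrbit.fiberLIntegral_count_mk, tsum_mul_mul_weight_eq Γ N (Φ := fun g => ‖Φ g‖ₑ) (Ψ := fun _ => (1 : ℝ≥0∞)) hΦ' (fun _ _ => rfl) hβ x.out,
      mul_one]
  rw [heq]
  exact measurable_fiberLIntegral Γ count ((hΦm.enorm.mul measurable_const).mul hβm)

end Measurable

section GenericL1

variable {G : Type*} [Group G] [TopologicalSpace G] [IsTopologicalGroup G] [LocallyCompactSpace G] [SecondCountableTopology G] [T2Space G]
  [MeasurableSpace G] [BorelSpace G] (Γ N : Subgroup G) [DiscreteTopology Γ]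
  [MeasurableSpace (G ⧸ Γ)] [BorelSpace (G ⧸ Γ)]
  (μ : Measure (G ⧸ Γ)) [SMulInvariantMeasure G (G ⧸ Γ) μ] [IsFiniteMeasureOnCompacts μ]
  (ν : Measure G) [IsHaarMeasure ν]

/-- **The `Γ`-fibre integral of `β • Φ` is `θ_Φ`, a.e.**: for `Φ` right-`N`-invariant with `∫⁻_{G⧸Γ} θ_{‖Φ‖} dμ < ∞` (`μ ≠ 0`) and a weight `β` of covering sum
one, `fiberIntegralE Γ count (β • Φ) = θ_Φ` `μ`-a.e. (★ `ae_integrable_fiber_of_integrable`, `integral_countable`, ★ F2a ℂ-regrouping).  In particular `θ_Φ` is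
a.e.-strongly measurable and integrable. [cite: MoeglinWaldspurger1995, II.1.2] -/
theorem fiberIntegralE_toReal_smul_ae_eq {Φ : G → ℂ} (hΦm : Measurable Φ) (hΦ : ∀ (g : G) (n : N), Φ (g * n) = Φ g)
    {β : G → ℝ≥0∞} (hβm : Measurable β) (hβ : ∀ g : G, ∑' γ' : N.subgroupOf Γ, β (g * ((γ' : Γ) : G)) = 1) (hμ : μ ≠ 0)
    (hfin : ∫⁻ x, ∑' q : Γ ⧸ N.subgroupOf Γ, ‖Φ (x.out * (q.out : G))‖ₑ ∂μ < ∞) :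
    Integrable (fun g : G => (β g).toReal • Φ g) ν ∧
      fiberIntegralE Γ count (fun g : G => (β g).toReal • Φ g) =ᵐ[μ] fun x => ∑' q : Γ ⧸ N.subgroupOf Γ, Φ (x.out * (q.out : G)) := by
  haveI : IsClosed (Γ : Set G) := Subgroup.isClosed_of_discrete
  have hβtop : ∀ y : G, β y ≠ ∞ := fun y => by
    have h := (ENNReal.le_tsum (1 : N.subgroupOf Γ)).trans (hβ y).le
    simp only [OneMemClass.coe_one, mul_one] at h
    exact ne_top_of_le_ne_top ENNReal.one_ne_top h
  -- integrability on `G` (★ F2a with `ψ = 1`)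
  have hfin1 : ∫⁻ x, (∑' q : Γ ⧸ N.subgroupOf Γ, ‖Φ (x.out * (q.out : G))‖ₑ) * ‖(fun _ : G ⧸ Γ => (1 : ℂ)) x‖ₑ ∂μ < ∞ := by
    simpa only [enorm_one, mul_one] using hfin
  have hFi' := integrable_weight_smul Γ N μ ν hΦm hΦ (ψ := fun _ => (1 : ℂ)) measurable_const hβm hβ hμ hfin1
  have hFi : Integrable (fun g : G => (β g).toReal • Φ g) ν := by
    refine hFi'.congr (Eventually.of_forall fun g => ?_)
    simp only [mul_one]
  have hFm : Measurable fun g : G => (β g).toReal • Φ g := hβm.ennreal_toReal.smul hΦm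
  refine ⟨hFi, ?_⟩
  filter_upwards [ae_integrable_fiber_of_integrable Γ count μ ν hFm hFi] with x hx
  have hxg : (QuotientGroup.mk x.out : G ⧸ Γ) = x := QuotientGroup.out_eq' x
  have hxint : Integrable (fun γ : Γ => (β (x.out * γ)).toReal • Φ (x.out * γ)) count := hx x.out hxg
  have h1 : fiberIntegralE Γ count (fun g : G => (β g).toReal • Φ g) x = ∑' γ : Γ, (β (x.out * γ)).toReal • Φ (x.out * γ) := by
    conv_lhs => rw [← hxg]
    rw [fiberIntegralE_mk, integral_countable hxint]
    refine tsum_congr fun γ => ?_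
    rw [count_real_singleton, one_smul]
  -- finiteness of `Σ_q ‖Φ(x̃ q̃)‖` from fibrewise integrability
  have hfinx : ∑' q : Γ ⧸ N.subgroupOf Γ, ‖Φ (x.out * (q.out : G))‖ₑ < ∞ := by
    have hlt := hxint.2
    rw [HasFiniteIntegral, lintegral_count] at hlt
    have h3 : ∀ γ : Γ, ‖(β (x.out * γ)).toReal • Φ (x.out * γ)‖ₑ = ‖Φ (x.out * γ)‖ₑ * 1 * β (x.out * γ) := fun γ => by
      rw [enorm_smul, Real.enorm_eq_ofReal ENNReal.toReal_nonneg, ENNReal.ofReal_toReal (hβtop _), mul_one, mul_comm]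
    simp_rw [h3] at hlt
    have hΦ' : ∀ (g : G) (n : N), ‖Φ (g * n)‖ₑ = ‖Φ g‖ₑ := fun g n => by rw [hΦ]
    rw [tsum_mul_mul_weight_eq Γ N (Φ := fun g => ‖Φ g‖ₑ) (Ψ := fun _ => (1 : ℝ≥0∞)) hΦ' (fun _ _ => rfl) hβ x.out, mul_one] at hlt
    exact hlt
  rw [h1]
  exact (summable_and_tsum_toReal_smul_eq_tsum_quotient Γ N hΦ hβ x.out hfinx).2

/-- `θ_Φ` is `μ`-integrable (hence a.e.-strongly measurable) as soon as `∫⁻_{G⧸Γ} θ_{‖Φ‖} dμ < ∞`. [cite: MoeglinWaldspurger1995, II.1.2] -/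
theorem integrable_pseudoEisenstein {Φ : G → ℂ} (hΦm : Measurable Φ) (hΦ : ∀ (g : G) (n : N), Φ (g * n) = Φ g) (hμ : μ ≠ 0)
    (hfin : ∫⁻ x, ∑' q : Γ ⧸ N.subgroupOf Γ, ‖Φ (x.out * (q.out : G))‖ₑ ∂μ < ∞) :
    Integrable (fun x : G ⧸ Γ => ∑' q : Γ ⧸ N.subgroupOf Γ, Φ (x.out * (q.out : G))) μ := by
  haveI : IsClosed (Γ : Set G) := Subgroup.isClosed_of_discrete
  obtain ⟨β, hβm, hβ⟩ := exists_weight Γ N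
  obtain ⟨hFi, hae⟩ := fiberIntegralE_toReal_smul_ae_eq Γ N μ haar hΦm hΦ hβm hβ hμ hfin
  exact (integrable_fiberIntegralE_of_integrable Γ count μ haar (hβm.ennreal_toReal.smul hΦm) hFi).congr hae

omit [SMulInvariantMeasure G (G ⧸ Γ) μ] [IsFiniteMeasureOnCompacts μ] in
/-- **HÖLDER**: if `∫⁻ θ_{‖Φ‖}² dμ < ∞` then `∫⁻ θ_{‖Φ‖} ‖ψ‖ dμ < ∞` for every `ψ ∈ L²(μ)`. [folklore] -/
theorem lintegral_tsum_enorm_mul_enorm_lt_top {Φ : G → ℂ} (hΦm : Measurable Φ) (hΦ : ∀ (g : G) (n : N), Φ (g * n) = Φ g)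
    (h2 : ∫⁻ x, (∑' q : Γ ⧸ N.subgroupOf Γ, ‖Φ (x.out * (q.out : G))‖ₑ) ^ 2 ∂μ < ∞) {ψ : G ⧸ Γ → ℂ} (hψ : MemLp ψ 2 μ) :
    ∫⁻ x, (∑' q : Γ ⧸ N.subgroupOf Γ, ‖Φ (x.out * (q.out : G))‖ₑ) * ‖ψ x‖ₑ ∂μ < ∞ := by
  have hθm := measurable_tsum_enorm Γ N hΦm hΦ
  have hH := ENNReal.lintegral_mul_le_Lp_mul_Lq μ Real.HolderConjugate.two_two hθm.aemeasurable hψ.1.aemeasurable.enorm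
  refine lt_of_le_of_lt hH (ENNReal.mul_lt_top ?_ ?_)
  · refine ENNReal.rpow_lt_top_of_nonneg (by norm_num) (lt_top_iff_ne_top.1 ?_)
    simpa only [ENNReal.rpow_two] using h2
  · refine ENNReal.rpow_lt_top_of_nonneg (by norm_num) (lt_top_iff_ne_top.1 ?_)
    have h := lintegral_rpow_enorm_lt_top_of_eLpNorm_lt_top (p := (2 : ℝ≥0∞)) (by norm_num) (by norm_num) hψ.2
    simpa only [ENNReal.toReal_ofNat] using h

/-- **`θ_Φ ∈ L²(μ)`** for a finite `μ` under `∫⁻ θ_{‖Φ‖}² dμ < ∞` (`‖θ_Φ‖ ≤ θ_{‖Φ‖}`, Mathlib `enorm_tsum_le_tsum_enorm`; a.e.-strong measurability from `θ_Φ ∈ L¹`,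
Cauchy–Schwarz). [cite: MoeglinWaldspurger1995, II.1.2] -/
theorem memLp_two_pseudoEisenstein [IsFiniteMeasure μ] {Φ : G → ℂ} (hΦm : Measurable Φ) (hΦ : ∀ (g : G) (n : N), Φ (g * n) = Φ g) (hμ : μ ≠ 0)
    (h2 : ∫⁻ x, (∑' q : Γ ⧸ N.subgroupOf Γ, ‖Φ (x.out * (q.out : G))‖ₑ) ^ 2 ∂μ < ∞) :
    MemLp (fun x : G ⧸ Γ => ∑' q : Γ ⧸ N.subgroupOf Γ, Φ (x.out * (q.out : G))) 2 μ := by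
  -- `θ_{‖Φ‖} ∈ L¹` by Cauchy–Schwarz against `1 ∈ L²(μ)`
  have hfin : ∫⁻ x, ∑' q : Γ ⧸ N.subgroupOf Γ, ‖Φ (x.out * (q.out : G))‖ₑ ∂μ < ∞ := by
    have h := lintegral_tsum_enorm_mul_enorm_lt_top Γ N μ hΦm hΦ h2 (memLp_const (1 : ℂ))
    simpa only [enorm_one, mul_one] using h
  have hae := (integrable_pseudoEisenstein Γ N μ hΦm hΦ hμ hfin).aestronglyMeasurable
  refine ⟨hae, ?_⟩
  rw [eLpNorm_lt_top_iff_lintegral_rpow_enorm_lt_top (by norm_num) (by norm_num), ENNReal.toReal_ofNat]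
  refine lt_of_le_of_lt (lintegral_mono fun x => ?_) (by simpa only [ENNReal.rpow_two] using h2)
  have hle : ‖∑' q : Γ ⧸ N.subgroupOf Γ, Φ (x.out * (q.out : G))‖ₑ ≤ ∑' q : Γ ⧸ N.subgroupOf Γ, ‖Φ (x.out * (q.out : G))‖ₑ :=
    enorm_tsum_le_tsum_enorm
  rw [ENNReal.rpow_two]
  exact pow_le_pow_left₀ bot_le hle 2

end GenericL1

section Adelic

variable {K : Type} [Field K] [NumberField K] (𝒢 : AdelicGroupData K)
  [MeasurableSpace 𝒢.Adelic] [BorelSpace 𝒢.Adelic] [LocallyCompactSpace 𝒢.Adelic] [SecondCountableTopology 𝒢.Adelic] [T2Space 𝒢.Adelic]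
  [DiscreteTopology 𝒢.quotientSubgroup] (hQ : 𝒢.quotientSubgroup = 𝒢.arithmeticSubgroup)
  (𝔓 : 𝒢.ParabolicUnipotentData) (i : 𝔓.ι) [hN : IsClosed ((𝔓.radical i : Subgroup 𝒢.Adelic) : Set 𝒢.Adelic)]
  (μ : Measure 𝒢.automorphicQuotient) [𝒢.IsAutomorphicMeasure μ]
  [MeasurableSpace (𝒢.Adelic ⧸ 𝔓.radical i)] [BorelSpace (𝒢.Adelic ⧸ 𝔓.radical i)]
  (μN : Measure (𝒢.Adelic ⧸ 𝔓.radical i)) [SMulInvariantMeasure 𝒢.Adelic (𝒢.Adelic ⧸ 𝔓.radical i) μN] [IsFiniteMeasureOnCompacts μN]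
  (ν : Measure 𝒢.Adelic) [IsHaarMeasure ν] (νN : Measure (𝔓.radical i)) [IsHaarMeasure νN] [SFinite νN] [νN.IsInvInvariant]

include hQ in
/-- **THE ADJUNCTION ON `X = G(𝔸) ⧸ G(K)`** (`A_G = 1`; ★ F2a `integrable_and_integral_pseudoEisenstein_mul_eq` with the tree's instances of the automorphic quotient
supplied inside the statement): for an automorphic `μ`, a Borel right-`N(𝔸)`-invariant `Φ`, a Borel `ψ : X → ℂ` with `∫⁻_X θ_{‖Φ‖}‖ψ‖ dμ < ∞` and every Haar `ν_N`,
fundamental domain `𝓕` of `𝔓.rational i`: `θ_Φ ψ ∈ L¹(μ)` and `c_N ∫_X θ_Φ ψ dμ = c_Γ ∫_{G(𝔸)⧸N(𝔸)} Φ(ỹ) (∫_𝓕 ψ((ỹ u⁻¹)·G(K)) dν_N(u)) dμ_N` — the inner integral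
being VERBATIM the ★ `ConstantTermVanishes` integrand. [cite: MoeglinWaldspurger1995, II.1.3] [cite: Garrett2018, §1.8] -/
theorem adelic_integrable_and_integral_pseudoEisenstein_mul_eq {Φ : 𝒢.Adelic → ℂ} (hΦm : Measurable Φ)
    (hΦ : ∀ (g : 𝒢.Adelic) (n : 𝔓.radical i), Φ (g * n) = Φ g) {ψ : 𝒢.automorphicQuotient → ℂ} (hψm : Measurable ψ)
    {𝓕 : Set (𝔓.radical i)} (h𝓕 : IsFundamentalDomain (𝔓.rational i) 𝓕 νN)
    (hfin : ∫⁻ x, (∑' q : 𝒢.quotientSubgroup ⧸ (𝔓.radical i).subgroupOf 𝒢.quotientSubgroup,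
        ‖Φ ((Quotient.out x : 𝒢.Adelic) * ((q.out : 𝒢.quotientSubgroup) : 𝒢.Adelic))‖ₑ) * ‖ψ x‖ₑ ∂μ < ∞) :
    letI := AdelicGroupData.measurableSpaceQuotientForm 𝒢
    haveI := AdelicGroupData.borelSpaceQuotientForm 𝒢
    haveI := AdelicGroupData.smulInvariantMeasureQuotientForm 𝒢 μ
    haveI := AdelicGroupData.isFiniteMeasureOnCompactsQuotientForm 𝒢 μ
    Integrable (fun x : 𝒢.automorphicQuotient => (∑' q : 𝒢.quotientSubgroup ⧸ (𝔓.radical i).subgroupOf 𝒢.quotientSubgroup,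
        Φ ((Quotient.out x : 𝒢.Adelic) * ((q.out : 𝒢.quotientSubgroup) : 𝒢.Adelic))) * ψ x) μ ∧
      ((unfoldingConstant (𝔓.radical i) νN μN ν : ℝ) : ℂ) *
          ∫ x, (∑' q : 𝒢.quotientSubgroup ⧸ (𝔓.radical i).subgroupOf 𝒢.quotientSubgroup,
            Φ ((Quotient.out x : 𝒢.Adelic) * ((q.out : 𝒢.quotientSubgroup) : 𝒢.Adelic))) * ψ x ∂μ =
        ((unfoldingConstant 𝒢.quotientSubgroup (count : Measure 𝒢.quotientSubgroup) μ ν : ℝ) : ℂ) *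
          ∫ y, Φ y.out * ∫ u in 𝓕, ψ (𝒢.toAutomorphicQuotient (y.out * (u : 𝒢.Adelic)⁻¹)) ∂νN ∂μN := by
  letI := AdelicGroupData.measurableSpaceQuotientForm 𝒢
  haveI := AdelicGroupData.borelSpaceQuotientForm 𝒢
  haveI := AdelicGroupData.smulInvariantMeasureQuotientForm 𝒢 μ
  haveI := AdelicGroupData.isFiniteMeasureOnCompactsQuotientForm 𝒢 μ
  rw [rational_eq_subgroupOf 𝒢 hQ 𝔓 i] at h𝓕
  exact integrable_and_integral_pseudoEisenstein_mul_eq 𝒢.quotientSubgroup (𝔓.radical i) μ μN ν νN hΦm hΦ hψm h𝓕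
    (AdelicGroupData.IsAutomorphicMeasure.ne_zero 𝒢 μ) hfin

include hQ in
/-- **`⟨θ_Φ, φ⟩ = 0` FOR A CONTINUOUS SQUARE-INTEGRABLE CUSP FORM `φ`** (`φ ∈ ★ cuspForms μ 𝔓`): `∫_X θ_Φ · conj φ dμ = 0`, provided `∫⁻_X θ_{‖Φ‖}‖φ‖ dμ < ∞` and
`μ_N ≠ 0`.  The constant term of `conj φ` along `N = 𝔓.radical i` vanishes at EVERY point (the definition of ★ `ConstantTermVanishes`, `integral_conj`), so
the right side of the adjunction is zero, and `c_N > 0`. [cite: MoeglinWaldspurger1995, II.1.3] [cite: BorelJacquet1979, §4.4] -/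
theorem integral_pseudoEisenstein_mul_conj_eq_zero_of_mem_cuspForms {Φ : 𝒢.Adelic → ℂ} (hΦm : Measurable Φ)
    (hΦ : ∀ (g : 𝒢.Adelic) (n : 𝔓.radical i), Φ (g * n) = Φ g) {φ : 𝒢.automorphicQuotient → ℂ} (hφ : φ ∈ 𝒢.cuspForms μ 𝔓)
    {𝓕 : Set (𝔓.radical i)} (h𝓕 : IsFundamentalDomain (𝔓.rational i) 𝓕 νN) (hμN : μN ≠ 0)
    (hfin : ∫⁻ x, (∑' q : 𝒢.quotientSubgroup ⧸ (𝔓.radical i).subgroupOf 𝒢.quotientSubgroup,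
        ‖Φ ((Quotient.out x : 𝒢.Adelic) * ((q.out : 𝒢.quotientSubgroup) : 𝒢.Adelic))‖ₑ) * ‖φ x‖ₑ ∂μ < ∞) :
    ∫ x, (∑' q : 𝒢.quotientSubgroup ⧸ (𝔓.radical i).subgroupOf 𝒢.quotientSubgroup,
        Φ ((Quotient.out x : 𝒢.Adelic) * ((q.out : 𝒢.quotientSubgroup) : 𝒢.Adelic))) * conj (φ x) ∂μ = 0 := by
  letI := AdelicGroupData.measurableSpaceQuotientForm 𝒢
  haveI := AdelicGroupData.borelSpaceQuotientForm 𝒢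
  haveI := AdelicGroupData.smulInvariantMeasureQuotientForm 𝒢 μ
  haveI := AdelicGroupData.isFiniteMeasureOnCompactsQuotientForm 𝒢 μ
  have hψm : Measurable fun x : 𝒢.automorphicQuotient => conj (φ x) := (Complex.continuous_conj.comp hφ.1).measurable
  have hfin' : ∫⁻ x, (∑' q : 𝒢.quotientSubgroup ⧸ (𝔓.radical i).subgroupOf 𝒢.quotientSubgroup,
      ‖Φ ((Quotient.out x : 𝒢.Adelic) * ((q.out : 𝒢.quotientSubgroup) : 𝒢.Adelic))‖ₑ) * ‖conj (φ x)‖ₑ ∂μ < ∞ := by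
    refine lt_of_le_of_lt (le_of_eq (lintegral_congr fun x => ?_)) hfin
    rw [← ofReal_norm (conj (φ x)), Complex.norm_conj, ofReal_norm]
  obtain ⟨-, h⟩ := adelic_integrable_and_integral_pseudoEisenstein_mul_eq 𝒢 hQ 𝔓 i μ μN haar νN hΦm hΦ hψm h𝓕 hfin'
  -- the constant terms of `conj φ` vanish at every point
  have hCT : ∀ y : 𝒢.Adelic ⧸ 𝔓.radical i,
      ∫ u in 𝓕, conj (φ (𝒢.toAutomorphicQuotient (y.out * (u : 𝒢.Adelic)⁻¹))) ∂νN = 0 := fun y => by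
    rw [integral_conj, ((hφ.2.2 i) νN 𝓕 h𝓕 y.out).2, map_zero]
  simp_rw [hCT, mul_zero, integral_zero, mul_zero] at h
  have hc : (unfoldingConstant (𝔓.radical i) νN μN (haar : Measure 𝒢.Adelic) : ℝ) ≠ 0 :=
    NNReal.coe_ne_zero.2 (unfoldingConstant_pos_of_ne_zero 𝒢.quotientSubgroup (𝔓.radical i) μ μN haar νN
      (AdelicGroupData.IsAutomorphicMeasure.ne_zero 𝒢 μ) hμN).2.ne'
  exact (mul_eq_zero.1 h).resolve_left (by exact_mod_cast hc)

end Adelic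

/-! ## §3 `θ_Φ ∈ (L²_cusp)ᗮ` -/

section LTwo

variable {K : Type} [Field K] [NumberField K] (𝒢 : AdelicGroupData K)
  [MeasurableSpace 𝒢.Adelic] [BorelSpace 𝒢.Adelic] [LocallyCompactSpace 𝒢.Adelic] [SecondCountableTopology 𝒢.Adelic] [T2Space 𝒢.Adelic]
  [DiscreteTopology 𝒢.quotientSubgroup] (hQ : 𝒢.quotientSubgroup = 𝒢.arithmeticSubgroup)
  (𝔓 : 𝒢.ParabolicUnipotentData) (i : 𝔓.ι) [hN : IsClosed ((𝔓.radical i : Subgroup 𝒢.Adelic) : Set 𝒢.Adelic)]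
  (μ : Measure 𝒢.automorphicQuotient) [𝒢.IsAutomorphicMeasure μ]
  [MeasurableSpace (𝒢.Adelic ⧸ 𝔓.radical i)] [BorelSpace (𝒢.Adelic ⧸ 𝔓.radical i)]
  (μN : Measure (𝒢.Adelic ⧸ 𝔓.radical i)) [SMulInvariantMeasure 𝒢.Adelic (𝒢.Adelic ⧸ 𝔓.radical i) μN] [IsFiniteMeasureOnCompacts μN]
  (νN : Measure (𝔓.radical i)) [IsHaarMeasure νN] [SFinite νN] [νN.IsInvInvariant]

omit hN [MeasurableSpace (𝒢.Adelic ⧸ 𝔓.radical i)] [BorelSpace (𝒢.Adelic ⧸ 𝔓.radical i)] in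
/-- **`θ_Φ ∈ L²(X, μ)`** for an automorphic `μ` under the square-integrability hypothesis `∫⁻_X θ_{‖Φ‖}² dμ < ∞` (§1 with the tree's instances).
[cite: MoeglinWaldspurger1995, II.1.2] -/
theorem memLp_two_pseudoEisenstein_automorphicQuotient {Φ : 𝒢.Adelic → ℂ} (hΦm : Measurable Φ)
    (hΦ : ∀ (g : 𝒢.Adelic) (n : 𝔓.radical i), Φ (g * n) = Φ g)
    (h2 : ∫⁻ x, (∑' q : 𝒢.quotientSubgroup ⧸ (𝔓.radical i).subgroupOf 𝒢.quotientSubgroup,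
        ‖Φ ((Quotient.out x : 𝒢.Adelic) * ((q.out : 𝒢.quotientSubgroup) : 𝒢.Adelic))‖ₑ) ^ 2 ∂μ < ∞) :
    MemLp (fun x : 𝒢.automorphicQuotient => ∑' q : 𝒢.quotientSubgroup ⧸ (𝔓.radical i).subgroupOf 𝒢.quotientSubgroup,
      Φ ((Quotient.out x : 𝒢.Adelic) * ((q.out : 𝒢.quotientSubgroup) : 𝒢.Adelic))) 2 μ := by
  letI := AdelicGroupData.measurableSpaceQuotientForm 𝒢
  haveI := AdelicGroupData.borelSpaceQuotientForm 𝒢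
  haveI := AdelicGroupData.smulInvariantMeasureQuotientForm 𝒢 μ
  haveI := AdelicGroupData.isFiniteMeasureOnCompactsQuotientForm 𝒢 μ
  haveI : @IsFiniteMeasure (𝒢.Adelic ⧸ 𝒢.quotientSubgroup) _ μ := ⟨measure_lt_top μ _⟩
  exact memLp_two_pseudoEisenstein 𝒢.quotientSubgroup (𝔓.radical i) μ hΦm hΦ (AdelicGroupData.IsAutomorphicMeasure.ne_zero 𝒢 μ) h2

include hQ μN νN in
/-- **`θ_Φ ∈ (L²_cusp)ᗮ`**: under `∫⁻_X θ_{‖Φ‖}² dμ < ∞` (and given a Haar `ν_N` with a fundamental domain for `𝔓.rational i`, an invariant `μ_N ≠ 0` on `G(𝔸)⧸N(𝔸)`), the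
`L²` class of `θ_Φ` is orthogonal to ★ `cuspidalSubspace μ 𝔓` — it is orthogonal to every `[φ]`, `φ ∈ cuspForms μ 𝔓` (§2 + Hölder), hence to the closure of their span
(Mathlib `Submodule.orthogonal_closure`). [cite: MoeglinWaldspurger1995, II.1.3] [cite: BorelJacquet1979, §4.6] -/
theorem toLp_pseudoEisenstein_mem_orthogonal_cuspidalSubspace {Φ : 𝒢.Adelic → ℂ} (hΦm : Measurable Φ)
    (hΦ : ∀ (g : 𝒢.Adelic) (n : 𝔓.radical i), Φ (g * n) = Φ g) {𝓕 : Set (𝔓.radical i)} (h𝓕 : IsFundamentalDomain (𝔓.rational i) 𝓕 νN) (hμN : μN ≠ 0)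
    (h2 : ∫⁻ x, (∑' q : 𝒢.quotientSubgroup ⧸ (𝔓.radical i).subgroupOf 𝒢.quotientSubgroup,
        ‖Φ ((Quotient.out x : 𝒢.Adelic) * ((q.out : 𝒢.quotientSubgroup) : 𝒢.Adelic))‖ₑ) ^ 2 ∂μ < ∞) :
    (memLp_two_pseudoEisenstein_automorphicQuotient 𝒢 𝔓 i μ hΦm hΦ h2).toLp _ ∈ ((𝒢.cuspidalSubspace μ 𝔓).toSubmodule)ᗮ := by
  letI := AdelicGroupData.measurableSpaceQuotientForm 𝒢
  haveI := AdelicGroupData.borelSpaceQuotientForm 𝒢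
  haveI := AdelicGroupData.smulInvariantMeasureQuotientForm 𝒢 μ
  haveI := AdelicGroupData.isFiniteMeasureOnCompactsQuotientForm 𝒢 μ
  rw [AdelicGroupData.toSubmodule_cuspidalSubspace, Submodule.orthogonal_closure, Submodule.mem_orthogonal]
  rintro _ ⟨φ, rfl⟩
  rw [AdelicGroupData.cuspFormsToLp_apply, MeasureTheory.L2.inner_def]
  have hφ2 : MemLp (φ : 𝒢.automorphicQuotient → ℂ) 2 μ := AdelicGroupData.memLp_of_mem_cuspForms φ.2
  -- the inner product is `∫ conj φ · θ_Φ dμ`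
  have hae : (fun x => ⟪(hφ2.toLp (φ : 𝒢.automorphicQuotient → ℂ)) x, ((memLp_two_pseudoEisenstein_automorphicQuotient 𝒢 𝔓 i μ hΦm hΦ h2).toLp _) x⟫_ℂ) =ᵐ[μ]
      fun x => (∑' q : 𝒢.quotientSubgroup ⧸ (𝔓.radical i).subgroupOf 𝒢.quotientSubgroup,
        Φ ((Quotient.out x : 𝒢.Adelic) * ((q.out : 𝒢.quotientSubgroup) : 𝒢.Adelic))) * conj ((φ : 𝒢.automorphicQuotient → ℂ) x) := by
    filter_upwards [hφ2.coeFn_toLp, (memLp_two_pseudoEisenstein_automorphicQuotient 𝒢 𝔓 i μ hΦm hΦ h2).coeFn_toLp] with x hx hθ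
    rw [hx, hθ, RCLike.inner_apply]
  rw [integral_congr_ae hae]
  exact integral_pseudoEisenstein_mul_conj_eq_zero_of_mem_cuspForms 𝒢 hQ 𝔓 i μ μN νN hΦm hΦ φ.2 h𝓕 hμN
    (lintegral_tsum_enorm_mul_enorm_lt_top 𝒢.quotientSubgroup (𝔓.radical i) μ hΦm hΦ h2 hφ2)

end LTwo

end Summit.HodgeConjecture.HodgeConjecture.Cruxes.H413.K2E1PseudoEisensteinCuspOrthogonal

end
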